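import Summits.BirchSwinnertonDyer.BirchSwinnertonDyer.Theses.TameQuarticSolvent
import Summits.BirchSwinnertonDyer.BirchSwinnertonDyer.Theses.TameQuarticManinParity
import Summits.BirchSwinnertonDyer.Rank1Residual.Additive.QuadraticTwistBSDComparisonIsogeny
import Literature.NumberTheory.EllipticCurves.Rank1Residual.Typed.HigherDescentSelmerCertificate
import Literature.NumberTheory.EllipticCurves.Rank1Residual.Typed.KolyvaginCertificate
import Literature.NumberTheory.EllipticCurves.IsogenyIdProofs
import HarnessLib

/-!
# The (t′) rank-one LEAF at `3` (`WAllExclAddTprimeAtThreeRankOne`, the common target of routes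
# `TameQuarticSolvent` and `TameQuarticManinParity`) in STABLE-Ш / DESCENT CERTIFICATE currency — BOTH halves,
# BY NAME, from PUB³ + one per-class certificate (no Iwasawa theory, no Euler system, no Manin constant)

HONEST FRAMING. Theorems only; helper (`--supports stmt-BirchSwinnertonDyer-21391`, width seat `bsd-wall-tqs-p1-w3`
gen 4), CONDITIONAL on every displayed hypothesis; credits nothing toward any item; BSD is not proved by any of this.
No definition, no named fact, no restatement (the leaf and the route decls are concluded BY NAME). Cell rule: per-class
certificates and an `N`-bounded census do NOT close a leaf — this is a PRICING device in the currency of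
`Typed/HigherDescentCertificate.lean` / `Typed/KolyvaginCertificate.lean` (cell b2b's X11-at-3 rank-one books), read
on the additive (t′) leaf at `3`, where no published half exists (Kato/Wuthrich need `3` non-additive; companion file
`TameQuarticSolventTprimeRankOneLowerDeepWitness.lean` prices the LOWER half alone).

THE CURRENCY. For `E` on the leaf (non-CM, additive (t′) at `3`, `ord_{s=1} L(E,s) = 1`) and ONE globally minimal
member `E′` of its Mazur class:

  STABLE CERTIFICATE at `(E′, k, m)`: `#Ш_an(E′) = q′ ∈ ℚ`, `ord₃ q′ = m`, `Ш(E′)[3^{k+1}] = Ш(E′)[3^k]`, `#Ш(E′)[3^k] = 3^m`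

(`k = 0, m = 0`: `3 ∤ #Ш_an(E′)` and `Ш(E′)[3] = 0` — ONE `3`-descent with `#Sel₃(E′) = 3^{r}·#E′(ℚ)[3]`; `k = 1, m = 2`:
`#Ш_an = 9`, `Ш(E′)[9] = Ш(E′)[3] ≅ (ℤ/3)²` — a `3`-descent plus a `9`-descent / Cassels–Tate-on-`Sel₃` computation).
Then Miller's `BSD(E′,3)` (`Typed.bsdp_of_stable`: GZK gives `rank = r_an` and `Ш` finite) and Cassels' isogeny
invariance (`TwistComparison.bsdp_of_bsdp_of_isIsogenous`: `hCassels` Milne ADT I.7.3, `hGZK`, `hmod`) give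
`BSD(E,3)`, i.e. the leaf at `E`. The cell is EXACT (§3): the leaf hands the certificate back on `E` itself with
`k = m = ord₃ #Ш(E)`, so nothing here is stronger than the rung, at any conductor.

INSTRUMENT (census `ROW2-AT3-SUBBLOCKS-v1.json` ⨝ Cremona `allbsd`, `N < 5·10⁵`; local python, no kit): the (t′)
rank-one leaf has 3 533 isogeny classes; `(k, m) = (0, 0)` is available on **3 526** (a member with `3 ∤ #Ш_an`:
ONE `3`-descent each, expected `dim Sel₃ = 1 + dim E′(ℚ)[3]`), `(k, m) = (1, 2)` on the **7** classes with
`#Ш_an = 9` on every member (`295911u`, `248256ca`, `151299b`, `235944v`, `376065h`, `377397a`, `395784w`; all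
`ρ̄₃` onto). So in CLASS currency the whole leaf — BOTH research cruxes of record, the UPPER half (TQS 21392 / TQMP
23736–23738: Kolyvagin + Manin `3`-unit at additive `3`) and the LOWER half (TQMP 23739) — is 3 533 per-class
descents modulo PUB³; none run here (ASK to a kit seat with the b2b `desc3` pipeline).

* §0 CLASS-FREE doors (any `p`, any reduction, analytic rank `≤ 1`): `bsdp_of_stable_of_isIsogenous`,
  `bsdp_of_shaAn_unit_of_noPTorsion_of_isIsogenous` (`k = 0`), `stable_zero_of_noPTorsion` /
  `card_torsionBy_pow_zero` (the unit certificate IS the level-`0` stable certificate).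
* §1 **THE LEAF BY NAME**: `wAllExclAddTprimeAtThreeRankOne_of_stableCertificates` (PUB³ + `hcert`);
  `…_of_unitDescent_of_stableCertificates` (unit classes by `Ш[3] = 0`, the rest by a stable certificate).
* §2 **ROUTE ITEMS BY NAME** from the same cell: TQS `TprimeRankOneUpperAtThree` (21392), TQMP
  `TprimeRankOneLowerAtThree` (23739), TQS `SolventPairLowerBound` (21391, + KT 19981 via p588900's shape is NOT
  repeated — see the companion file; here 21391's own `E`-half only enters through the leaf).
* §3 EXACTNESS: `stableCertificate_of_bsdp`, `stableCertificates_of_wAllExclAddTprimeAtThreeRankOne`.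

References: J. W. S. Cassels, J. reine angew. Math. 217 (1965) 180–199; J. S. Milne, *Arithmetic Duality Theorems*
(2006) Thm. I.7.3; J. H. Silverman, *AEC* (2009) Thm. X.4.2; R. L. Miller, LMS J. Comput. Math. 14 (2011) §1, Def. 1.1;
E. F. Schaefer, M. Stoll, Trans. AMS 356 (2004) 1209–1231; B. Creutz, R. L. Miller, J. Algebra 372 (2012) 673–701
(second `p`-descents); J. E. Cremona, *ecdata* (`allbsd`).
-/

-- D-0017: single-problem summit, so `Summit.BirchSwinnertonDyer.BirchSwinnertonDyer.…` repeats a namespace BY DESIGN.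
set_option linter.dupNamespace false
set_option autoImplicit false

noncomputable section

open scoped Classical

open WeierstrassCurve Literature.NumberTheory.EllipticCurves Literature.NumberTheory.EllipticCurves.ModularForms
  Literature.NumberTheory.EllipticCurves.Rank1Residual Literature.NumberTheory.EllipticCurves.Rank1Residual.Typed
  Summit.BirchSwinnertonDyer.Rank1Residual.Additive

namespace Summit.BirchSwinnertonDyer.BirchSwinnertonDyer.Theorems.TprimeRankOneStableCertificate

/-! ## §0 Class-free doors: `BSD(E,p)` from a stable certificate read on an isogenous curve (rank `≤ 1`, any `p`) -/

/-- **`BSD(E,p)` from a STABLE CERTIFICATE on an isogenous curve.** `W ∼ W'` over `ℚ` (both globally minimal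
elliptic), `ord_{s=1} L(W,s) ≤ 1`; ON `W'`: `Ш(W')[p^{k+1}] = Ш(W')[p^k]`, `#Ш(W')[p^k] = p^m`, `#Ш_an(W') = q'`
rational with `ord_p q' = m`. Then `BSDp W p`: `BSD(W',p)` by `Typed.bsdp_of_stable` (GZK `hGZK`; equal analytic
ranks, Knapp 11.67), transported by Cassels' isogeny invariance (`hCassels`, modularity `hmod`;
`TwistComparison.bsdp_of_bsdp_of_isIsogenous`). Per curve; never a class theorem. CONDITIONAL.
[cite: MilneADT2006, Thm. I.7.3] [cite: Miller2011LMS, §1 and Def. 1.1] [cite: Knapp1993, Thm. 11.67 (PDF p. 281)] -/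
theorem bsdp_of_stable_of_isIsogenous (hCassels : bsdRHS_eq_of_isIsogenous)
    (hGZK : rank_eq_analyticRank_of_analyticRank_le_one) (hmod : hasEntireLFunction_rat)
    (W W' : WeierstrassCurve ℚ) [W.IsElliptic] [W.IsGloballyMinimal] [W'.IsElliptic] [W'.IsGloballyMinimal]
    (hiso : IsIsogenous W W') (p : ℕ) [Fact p.Prime] (hr : W.analyticRank ≤ 1) {k m : ℕ}
    (hstab : ∀ x : W'.sha, p ^ (k + 1) • x = 0 → p ^ k • x = 0)
    (hcard : Nat.card (AddSubgroup.torsionBy W'.sha (p ^ k : ℕ)) = p ^ m)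
    {q' : ℚ} (hq' : shaAn W' = (q' : ℂ)) (hv : padicValRat p q' = m) : BSDp W p := by
  have hr' : W'.analyticRank ≤ 1 := by rw [← analyticRank_eq_of_isIsogenous' hiso]; exact hr
  exact TwistComparison.bsdp_of_bsdp_of_isIsogenous W' W p hCassels hGZK hmod hiso.symm_of_isElliptic hr'
    (bsdp_of_stable W' p hGZK hr' hstab hcard hq' hv)

/-- **The UNIT certificate on an isogenous curve (`k = m = 0`).** `W ∼ W'`, `ord_{s=1} L(W,s) ≤ 1`; on `W'`:
`#Ш_an(W') = q'` with `ord_p q' = 0` and `Ш(W')[p] = 0` (ONE `p`-descent: `#Sel^{(p)}(W') = p^{rank}·#W'(ℚ)[p]`).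
Then `BSDp W p` (`Typed.bsdp_of_shaAn_unit_of_noPTorsion` + Cassels transport). CONDITIONAL; per curve.
[cite: MilneADT2006, Thm. I.7.3] [cite: Miller2011LMS, §1 and Def. 1.1] -/
theorem bsdp_of_shaAn_unit_of_noPTorsion_of_isIsogenous (hCassels : bsdRHS_eq_of_isIsogenous)
    (hGZK : rank_eq_analyticRank_of_analyticRank_le_one) (hmod : hasEntireLFunction_rat)
    (W W' : WeierstrassCurve ℚ) [W.IsElliptic] [W.IsGloballyMinimal] [W'.IsElliptic] [W'.IsGloballyMinimal]
    (hiso : IsIsogenous W W') (p : ℕ) [Fact p.Prime] (hr : W.analyticRank ≤ 1)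
    {q' : ℚ} (hq' : shaAn W' = (q' : ℂ)) (hv : padicValRat p q' = 0)
    (hno : ∀ x : W'.sha, (p : ℤ) • x = 0 → x = 0) : BSDp W p := by
  have hr' : W'.analyticRank ≤ 1 := by rw [← analyticRank_eq_of_isIsogenous' hiso]; exact hr
  exact TwistComparison.bsdp_of_bsdp_of_isIsogenous W' W p hCassels hGZK hmod hiso.symm_of_isElliptic hr'
    (bsdp_of_shaAn_unit_of_noPTorsion W' p hGZK hr' hq' hv hno)

/-- `Ш[p] = 0` is stabilisation at level `0`: `p • x = 0 → x = 0`, i.e. `p^{0+1} • x = 0 → p^0 • x = 0`.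
Bookkeeping. [folklore] -/
theorem stable_zero_of_noPTorsion {A : Type*} [AddCommGroup A] (p : ℕ)
    (hno : ∀ x : A, (p : ℤ) • x = 0 → x = 0) : ∀ x : A, p ^ (0 + 1) • x = 0 → p ^ 0 • x = 0 := by
  intro x hx
  rw [zero_add, pow_one] at hx
  rw [pow_zero, one_nsmul]
  exact hno x (by rw [natCast_zsmul]; exact hx)

/-- `#A[1] = 1 = p^0`. Bookkeeping. [folklore] -/
theorem card_torsionBy_pow_zero {A : Type*} [AddCommGroup A] (p : ℕ) :
    Nat.card (AddSubgroup.torsionBy A (p ^ 0 : ℕ)) = p ^ 0 := by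
  rw [pow_zero]
  have h : AddSubgroup.torsionBy A (1 : ℕ) = ⊥ := by
    ext x
    simp
  rw [h]
  exact Nat.card_unique

/-! ## §1 The (t′) rank-one leaf BY NAME from PUB³ + one stable certificate per class -/

/-- **`WAllExclAddTprimeAtThreeRankOne` ⟸ PUB³ + STABLE CERTIFICATES.** GIVEN Cassels' isogeny invariance
(`hCassels`), Gross–Zagier–Kolyvagin (`hGZK`), modularity (`hmod`), and — for every non-CM globally minimal (t′)
curve `W` at `3` with `ord_{s=1} L(W,s) = 1` — ONE globally minimal `W' ∼ W` with a stable certificate at `3`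
(`hcert`: `#Ш_an(W') = q'`, `ord₃ q' = m`, `Ш(W')[3^{k+1}] = Ш(W')[3^k]`, `#Ш(W')[3^k] = 3^m`), the registered
W-ALL leaf holds: `BSD(E,3)` on the whole (t′) rank-one leaf. Census (`N < 5·10⁵`): `(k,m) = (0,0)` on 3 526 /
3 533 classes, `(1,2)` on 7. CONDITIONAL; credits nothing; `hcert` is implied by the leaf (§3).
[cite: MilneADT2006, Thm. I.7.3] [cite: SilvermanAEC2009, Thm. X.4.2] [cite: Miller2011LMS, §1 and Def. 1.1] -/
theorem wAllExclAddTprimeAtThreeRankOne_of_stableCertificates (hCassels : bsdRHS_eq_of_isIsogenous)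
    (hGZK : rank_eq_analyticRank_of_analyticRank_le_one) (hmod : hasEntireLFunction_rat)
    (hcert : ∀ (W : WeierstrassCurve ℚ) [W.IsElliptic] [W.IsGloballyMinimal],
      ¬ W.HasCM → Addv W 3 → SubTprime W 3 → W.analyticRank = 1 →
      ∃ (W' : WeierstrassCurve ℚ) (_ : W'.IsElliptic) (_ : W'.IsGloballyMinimal), IsIsogenous W W' ∧
        ∃ q : ℚ, shaAn W' = (q : ℂ) ∧ ∃ k m : ℕ, padicValRat 3 q = m ∧
          (∀ x : W'.sha, 3 ^ (k + 1) • x = 0 → 3 ^ k • x = 0) ∧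
          Nat.card (AddSubgroup.torsionBy W'.sha (3 ^ k : ℕ)) = 3 ^ m) :
    Summit.BirchSwinnertonDyer.WAllExclAddTprimeAtThreeRankOne := by
  intro W _ _ hCM hadd hsub hr
  haveI : Fact (Nat.Prime 3) := ⟨Nat.prime_three⟩
  obtain ⟨W', iE, iM, hiso, q, hq, k, m, hv, hstab, hcard⟩ := hcert W hCM hadd hsub hr
  exact bsdp_of_stable_of_isIsogenous hCassels hGZK hmod W W' hiso 3 (by omega) hstab hcard hq hv

/-- **The leaf ⟸ PUB³ + the UNIT-DESCENT cell on the unit classes + STABLE certificates on the rest.** Per class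
EITHER a member `W'` with `3 ∤ #Ш_an(W')` and `Ш(W')[3] = 0` (ONE `3`-descent; census 3 526 classes) OR a member
with a stable certificate (census 7 classes at `(1,2)`). CONDITIONAL; credits nothing.
[cite: MilneADT2006, Thm. I.7.3] [cite: SilvermanAEC2009, Thm. X.4.2] [cite: Miller2011LMS, §1 and Def. 1.1] -/
theorem wAllExclAddTprimeAtThreeRankOne_of_unitDescent_of_stableCertificates
    (hCassels : bsdRHS_eq_of_isIsogenous) (hGZK : rank_eq_analyticRank_of_analyticRank_le_one)
    (hmod : hasEntireLFunction_rat)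
    (hcells : ∀ (W : WeierstrassCurve ℚ) [W.IsElliptic] [W.IsGloballyMinimal],
      ¬ W.HasCM → Addv W 3 → SubTprime W 3 → W.analyticRank = 1 →
      (∃ (W' : WeierstrassCurve ℚ) (_ : W'.IsElliptic) (_ : W'.IsGloballyMinimal), IsIsogenous W W' ∧
        ∃ q : ℚ, shaAn W' = (q : ℂ) ∧ padicValRat 3 q = 0 ∧ ∀ x : W'.sha, (3 : ℤ) • x = 0 → x = 0) ∨
      (∃ (W' : WeierstrassCurve ℚ) (_ : W'.IsElliptic) (_ : W'.IsGloballyMinimal), IsIsogenous W W' ∧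
        ∃ q : ℚ, shaAn W' = (q : ℂ) ∧ ∃ k m : ℕ, padicValRat 3 q = m ∧
          (∀ x : W'.sha, 3 ^ (k + 1) • x = 0 → 3 ^ k • x = 0) ∧
          Nat.card (AddSubgroup.torsionBy W'.sha (3 ^ k : ℕ)) = 3 ^ m)) :
    Summit.BirchSwinnertonDyer.WAllExclAddTprimeAtThreeRankOne := by
  intro W _ _ hCM hadd hsub hr
  haveI : Fact (Nat.Prime 3) := ⟨Nat.prime_three⟩
  rcases hcells W hCM hadd hsub hr with ⟨W', iE, iM, hiso, q, hq, hv, hno⟩ |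
    ⟨W', iE, iM, hiso, q, hq, k, m, hv, hstab, hcard⟩
  · exact bsdp_of_shaAn_unit_of_noPTorsion_of_isIsogenous hCassels hGZK hmod W W' hiso 3 (by omega) hq hv
      hno
  · exact bsdp_of_stable_of_isIsogenous hCassels hGZK hmod W W' hiso 3 (by omega) hstab hcard hq hv

/-! ## §2 The route items on this leaf BY NAME from the same cell -/

/-- **TQS item `TprimeRankOneUpperAtThree` (stmt-BirchSwinnertonDyer-21392: the Euler-system UPPER half
`ord₃ #Ш ≤ ord₃ #Ш_an` on the (t′) rank-one leaf) ⟸ PUB³ + STABLE CERTIFICATES** — through the leaf (§1) and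
`Typed.missingPPartAt_of_bsdp` (no Kolyvagin system, no Manin constant). Census: on the 3 526 unit classes the
upper half IS the content of `BSD(E,3)` (certificate `Ш(W')[3] = 0`). CONDITIONAL; credits nothing.
[cite: MilneADT2006, Thm. I.7.3] [cite: Miller2011LMS, §1 and Def. 1.1] -/
theorem tprimeRankOneUpperAtThree_of_stableCertificates (hCassels : bsdRHS_eq_of_isIsogenous)
    (hGZK : rank_eq_analyticRank_of_analyticRank_le_one) (hmod : hasEntireLFunction_rat)
    (hcert : ∀ (W : WeierstrassCurve ℚ) [W.IsElliptic] [W.IsGloballyMinimal],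
      ¬ W.HasCM → Addv W 3 → SubTprime W 3 → W.analyticRank = 1 →
      ∃ (W' : WeierstrassCurve ℚ) (_ : W'.IsElliptic) (_ : W'.IsGloballyMinimal), IsIsogenous W W' ∧
        ∃ q : ℚ, shaAn W' = (q : ℂ) ∧ ∃ k m : ℕ, padicValRat 3 q = m ∧
          (∀ x : W'.sha, 3 ^ (k + 1) • x = 0 → 3 ^ k • x = 0) ∧
          Nat.card (AddSubgroup.torsionBy W'.sha (3 ^ k : ℕ)) = 3 ^ m) :
    Summit.BirchSwinnertonDyer.BirchSwinnertonDyer.Theses.TameQuarticSolvent.TprimeRankOneUpperAtThree := by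
  intro W _ _ hCM hadd hsub hr
  haveI : Fact (Nat.Prime 3) := ⟨Nat.prime_three⟩
  haveI : Finite W.sha := (hGZK W (by omega)).2
  exact (lower_and_upper_of_missingPPartAt W 3 (missingPPartAt_of_bsdp W 3
    (wAllExclAddTprimeAtThreeRankOne_of_stableCertificates hCassels hGZK hmod hcert W hCM hadd hsub hr))).2

/-- **TQMP item `TprimeRankOneLowerAtThree` (stmt-BirchSwinnertonDyer-23739: the LOWER half on the (t′) rank-one
leaf — the one item TQS 21391 hinges on) ⟸ PUB³ + STABLE CERTIFICATES**, through the leaf (§1). (The companion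
file gives it from the weaker deep-witness cell + Cassels–Tate.) CONDITIONAL; credits nothing.
[cite: MilneADT2006, Thm. I.7.3] [cite: Miller2011LMS, §1 and Def. 1.1] -/
theorem tprimeRankOneLowerAtThree_of_stableCertificates (hCassels : bsdRHS_eq_of_isIsogenous)
    (hGZK : rank_eq_analyticRank_of_analyticRank_le_one) (hmod : hasEntireLFunction_rat)
    (hcert : ∀ (W : WeierstrassCurve ℚ) [W.IsElliptic] [W.IsGloballyMinimal],
      ¬ W.HasCM → Addv W 3 → SubTprime W 3 → W.analyticRank = 1 →
      ∃ (W' : WeierstrassCurve ℚ) (_ : W'.IsElliptic) (_ : W'.IsGloballyMinimal), IsIsogenous W W' ∧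
        ∃ q : ℚ, shaAn W' = (q : ℂ) ∧ ∃ k m : ℕ, padicValRat 3 q = m ∧
          (∀ x : W'.sha, 3 ^ (k + 1) • x = 0 → 3 ^ k • x = 0) ∧
          Nat.card (AddSubgroup.torsionBy W'.sha (3 ^ k : ℕ)) = 3 ^ m) :
    Summit.BirchSwinnertonDyer.BirchSwinnertonDyer.Theses.TameQuarticManinParity.TprimeRankOneLowerAtThree := by
  intro W _ _ hCM hadd hsub hr
  haveI : Fact (Nat.Prime 3) := ⟨Nat.prime_three⟩
  haveI : Finite W.sha := (hGZK W (by omega)).2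
  exact (lower_and_upper_of_missingPPartAt W 3 (missingPPartAt_of_bsdp W 3
    (wAllExclAddTprimeAtThreeRankOne_of_stableCertificates hCassels hGZK hmod hcert W hCM hadd hsub hr))).1

/-! ## §3 Exactness: the leaf hands the certificate back on the curve itself -/

/-- **`BSD(E,p)` with `Ш` finite IS a stable certificate on `E`** at `k = m = ord_p #Ш(E)`: every element of the
`p`-primary component is killed by its order `p^m` (Lagrange), so `Ш[p^{m+1}] ⊆ Ш(p) ⊆ Ш[p^m]`; the count
`#Ш[p^m] = p^m` is `Typed.card_torsionBy_eq_pow_padicValNat_of_stable`; and Miller's clause reads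
`ord_p #Ш_an = ord_p #Ш(p) = ord_p #Ш`. Elementary. [cite: Miller2011LMS, Def. 1.1 (arXiv:1010.2431 p. 3)] -/
theorem stableCertificate_of_bsdp (W : WeierstrassCurve ℚ) [W.IsElliptic] (p : ℕ) [Fact p.Prime]
    (hfin : Finite W.sha) (h : BSDp W p) :
    ∃ q : ℚ, shaAn W = (q : ℂ) ∧ ∃ k m : ℕ, padicValRat p q = m ∧
      (∀ x : W.sha, p ^ (k + 1) • x = 0 → p ^ k • x = 0) ∧
      Nat.card (AddSubgroup.torsionBy W.sha (p ^ k : ℕ)) = p ^ m := by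
  obtain ⟨-, -, q, hq, hval⟩ := h
  haveI := hfin
  set v : ℕ := padicValNat p (Nat.card W.sha) with hv
  -- every `p`-primary element is killed by `p ^ v = #Ш(p)`
  have hkill : ∀ x : W.sha, x ∈ AddCommGroup.primaryComponent W.sha p → p ^ v • x = 0 := by
    intro x hx
    have hcardP : Nat.card (AddCommGroup.primaryComponent W.sha p) = p ^ v := by
      rw [hv, card_addPrimaryComponent_eq_pow, Nat.factorization_def _ (Fact.out : p.Prime)]
    have h1 : addOrderOf (⟨x, hx⟩ : AddCommGroup.primaryComponent W.sha p) ∣ p ^ v :=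
      hcardP ▸ addOrderOf_dvd_natCard _
    have h2 : p ^ v • (⟨x, hx⟩ : AddCommGroup.primaryComponent W.sha p) = 0 :=
      addOrderOf_dvd_iff_nsmul_eq_zero.mp h1
    have h3 := congrArg ((↑) : AddCommGroup.primaryComponent W.sha p → W.sha) h2
    rw [AddSubgroupClass.coe_nsmul, ZeroMemClass.coe_zero] at h3
    exact h3
  have hstab : ∀ x : W.sha, p ^ (v + 1) • x = 0 → p ^ v • x = 0 := fun x hx =>
    hkill x ((AddCommGroup.mem_primaryComponent).mpr ⟨v + 1, hx⟩)
  refine ⟨q, hq, v, v, ?_, hstab, card_torsionBy_eq_pow_padicValNat_of_stable hstab⟩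
  rw [hval, padicValNat_card_addPrimaryComponent]

/-- **EXACTNESS from the leaf.** `WAllExclAddTprimeAtThreeRankOne` gives the stable-certificate cell `hcert` of §1
with `W' = W` (GZK `hGZK` for `Ш` finite). So the cell is never stronger than the rung, at any conductor.
[cite: Miller2011LMS, Def. 1.1 (arXiv:1010.2431 p. 3)] -/
theorem stableCertificates_of_wAllExclAddTprimeAtThreeRankOne
    (hGZK : rank_eq_analyticRank_of_analyticRank_le_one)
    (hleaf : Summit.BirchSwinnertonDyer.WAllExclAddTprimeAtThreeRankOne) :
    ∀ (W : WeierstrassCurve ℚ) [W.IsElliptic] [W.IsGloballyMinimal],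
      ¬ W.HasCM → Addv W 3 → SubTprime W 3 → W.analyticRank = 1 →
      ∃ (W' : WeierstrassCurve ℚ) (_ : W'.IsElliptic) (_ : W'.IsGloballyMinimal), IsIsogenous W W' ∧
        ∃ q : ℚ, shaAn W' = (q : ℂ) ∧ ∃ k m : ℕ, padicValRat 3 q = m ∧
          (∀ x : W'.sha, 3 ^ (k + 1) • x = 0 → 3 ^ k • x = 0) ∧
          Nat.card (AddSubgroup.torsionBy W'.sha (3 ^ k : ℕ)) = 3 ^ m := by
  intro W iE iM hCM hadd hsub hr
  haveI : Fact (Nat.Prime 3) := ⟨Nat.prime_three⟩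
  exact ⟨W, iE, iM, isIsogenous_self W,
    stableCertificate_of_bsdp W 3 (hGZK W (by omega)).2 (hleaf W hCM hadd hsub hr)⟩

/-- **The unit-descent cell IS the level-`0` stable certificate** (`k = m = 0`): `3 ∤ #Ш_an(W')` and
`Ш(W')[3] = 0` give the stable certificate at `(0, 0)`. Bookkeeping (§0's two lemmas). [folklore] -/
theorem stableCertificate_of_unitDescent (W' : WeierstrassCurve ℚ) {q : ℚ} (hq : shaAn W' = (q : ℂ))
    (hv : padicValRat 3 q = 0) (hno : ∀ x : W'.sha, (3 : ℤ) • x = 0 → x = 0) :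
    ∃ q : ℚ, shaAn W' = (q : ℂ) ∧ ∃ k m : ℕ, padicValRat 3 q = m ∧
      (∀ x : W'.sha, 3 ^ (k + 1) • x = 0 → 3 ^ k • x = 0) ∧
      Nat.card (AddSubgroup.torsionBy W'.sha (3 ^ k : ℕ)) = 3 ^ m :=
  ⟨q, hq, 0, 0, by simpa using hv, stable_zero_of_noPTorsion 3 (by exact_mod_cast hno),
    card_torsionBy_pow_zero 3⟩

end Summit.BirchSwinnertonDyer.BirchSwinnertonDyer.Theorems.TprimeRankOneStableCertificate

end
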